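import Literature.AlgebraicGeometry.Resolution.FiniteDeterminacy
import Literature.AlgebraicGeometry.Resolution.FormalInverseFunction
import Literature.RingTheory.MvPowerSeries.MaximalIdealPow
import HarnessLib

/-!
# Proof of Boubakri–Greuel–Markwig, Theorem 2.1 (finite determinacy in arbitrary characteristic)

This file discharges the named fact `BoubakriGreuelMarkwig.Thm21` of `FiniteDeterminacy.lean`:
`theorem Thm21_holds : Thm21`. Source: Y. Boubakri, G.-M. Greuel, T. Markwig, *Invariants of
hypersurface singularities in positive characteristic*, Rev. Mat. Complut. 25 (2012) 61–85 =
arXiv:1005.4503, Theorem 2.1 and Lemma 2.2 (pp. 6–7 of the arXiv text). [BoubakriGreuelMarkwig2010]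

We follow the printed proof (successive substitutions `xᵢ ↦ xᵢ + bᵢ` converging `𝔪`-adically) in
`R = K⟦x₁,…,xₙ⟧ = MvPowerSeries (Fin n) K`, `𝔪 = maximalIdeal R`:

* §A  `𝔪`-adic bookkeeping (`𝔪 ^ N` = series of order `≥ N`, from
  `Literature.RingTheory.MvPowerSeries.Jets`); `∂ᵢ 𝔪ᵈ ⊆ 𝔪ᵈ⁻¹`; `⋂ 𝔪ᵈ = 0`; `𝔪`-adic completeness.
* §B  the substitution endomorphisms `φ_b : xᵢ ↦ xᵢ + bᵢ` (`MvPowerSeries.substAlgHom`); they are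
  automorphisms for `bᵢ ∈ 𝔪²` by the tree's formal inverse function theorem
  (`FormalCoordChange.subst_invT`, `subst_invT_left`); two `K`-algebra endomorphisms congruent on
  the variables modulo `𝔪ᴺ` are congruent modulo `𝔪ᴺ` everywhere.
* §C  the first-order Taylor estimate of the printed proof,
  `φ_b(a) - a - ∑ᵢ ∂ᵢa · bᵢ ∈ 𝔪^(d + 2M)` for `a ∈ 𝔪ᵈ`, `bᵢ ∈ 𝔪^(M+1)` (the paper expands
  `f(x + z) = ∑ h_α z^α` with `ord h_α ≥ o - |α|`; we obtain the same bound by induction over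
  monomials from `E(xᵢc) = bᵢ·δc + (xᵢ + bᵢ)·E(c)` and truncation — same content, less notation).
* §D  the iteration of the proof of Thm. 2.1 with the recursion of Lemma 2.2
  (`u_{p+1} = (1 + b_{p,0})·φ_p(u_p)`, `Φ_{p+1} = φ_p ∘ Φ_p`, residual in `𝔪^(N+1+p)`), its
  `𝔪`-adic limit, and the conclusion `g = u · Φ(f)`; the residual at stage `p` is decomposed with
  the hypothesis for the ORIGINAL `f` and then rewritten in terms of `u_p Φ_p(f) ≡ f (mod 𝔪^(N+1))`
  at a cost in `𝔪^(N+2+p)` (this replaces the paper's "replace `f` by `v₁φ₁(f)` and go on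
  inductively", which silently uses the invariance of the hypothesis under the contact group).
* §E  `Thm21_holds`: the numerology `ord f ≤ k + 1`, `N = 2k - ord f + 2`, `M = N - k ≥ 1` of the
  first lines of the printed proof, and the two decompositions
  `𝔪^(N+1+p) = 𝔪^(M-1+p)·𝔪^(k+2) ⊆ 𝔪^(M+p)·⟨f⟩ + 𝔪^(M+1+p)·j(f)` (contact) resp.
  `⊆ 𝔪^(M+1+p)·j(f)` (right).

As observed in the docstring of `FiniteDeterminacy.lean`, the printed proof uses neither the
algebraic closedness of `K` nor `n ≥ 2`; everything below is proved for an arbitrary field `K` and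
any `n ≥ 1`, and specialised at the end. No definitions are introduced (the substitution
`xᵢ ↦ xᵢ + bᵢ` is `MvPowerSeries.substAlgHom` of the family `fun i => X i + b i`).
-/

noncomputable section

namespace Literature.AlgebraicGeometry.Resolution

namespace BoubakriGreuelMarkwig

open IsLocalRing _root_.MvPowerSeries
open Literature.RingTheory.MvPowerSeries.Jets
open Literature.AlgebraicGeometry.Resolution.FormalCoordChange

variable {K : Type*} [Field K] {n : ℕ}

/-! ### §A. `𝔪`-adic bookkeeping in `K⟦x₁,…,xₙ⟧` -/

/-- `𝔪 ^ d' ⊆ 𝔪 ^ d` for `d ≤ d'`. [folklore] -/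
theorem mem_pow_of_le {a : MvPowerSeries (Fin n) K} {d d' : ℕ} (h : d ≤ d')
    (ha : a ∈ maximalIdeal (MvPowerSeries (Fin n) K) ^ d') :
    a ∈ maximalIdeal (MvPowerSeries (Fin n) K) ^ d :=
  Ideal.pow_le_pow_right h ha

/-- `𝔪ᵈ · 𝔪ᵉ ⊆ 𝔪ᵈ⁺ᵉ` on elements. [folklore] -/
theorem mul_mem_pow_add {a b : MvPowerSeries (Fin n) K} {d e : ℕ}
    (ha : a ∈ maximalIdeal (MvPowerSeries (Fin n) K) ^ d)
    (hb : b ∈ maximalIdeal (MvPowerSeries (Fin n) K) ^ e) :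
    a * b ∈ maximalIdeal (MvPowerSeries (Fin n) K) ^ (d + e) := by
  rw [pow_add]
  exact Ideal.mul_mem_mul ha hb

/-- Krull for `K⟦x⟧`: `⋂_d 𝔪ᵈ = 0` (a series in every `𝔪ᵈ` has no coefficients). [folklore] -/
theorem eq_zero_of_forall_mem_pow {a : MvPowerSeries (Fin n) K}
    (h : ∀ d, a ∈ maximalIdeal (MvPowerSeries (Fin n) K) ^ d) : a = 0 := by
  ext e
  rw [map_zero]
  exact coeff_eq_zero_of_mem_maximalIdeal_pow (h (e.degree + 1)) (Nat.lt_succ_self _)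

/-- Elements of `𝔪ᵈ`, `d ≥ 1`, have no constant term. [folklore] -/
theorem constantCoeff_eq_zero_of_mem_pow {a : MvPowerSeries (Fin n) K} {d : ℕ} (hd : 1 ≤ d)
    (ha : a ∈ maximalIdeal (MvPowerSeries (Fin n) K) ^ d) : constantCoeff a = 0 :=
  mem_maximalIdeal_iff_constantCoeff_eq_zero.mp (Ideal.pow_le_self (by omega) ha)

/-- `∂ᵢ` lowers the `𝔪`-adic order by at most one: `∂ᵢ 𝔪ᵈ ⊆ 𝔪ᵈ⁻¹`. [folklore] -/
theorem pderiv_mem_pow {a : MvPowerSeries (Fin n) K} {d : ℕ}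
    (ha : a ∈ maximalIdeal (MvPowerSeries (Fin n) K) ^ d) (i : Fin n) :
    MvPowerSeries.pderiv i a ∈ maximalIdeal (MvPowerSeries (Fin n) K) ^ (d - 1) := by
  rw [mem_maximalIdeal_pow_iff] at ha ⊢
  intro e he
  rw [MvPowerSeries.coeff_pderiv, ha _ ?_, mul_zero]
  rw [map_add, Finsupp.degree_single]
  omega

/-- `f ∈ 𝔪 ^ ord f`. [folklore] -/
theorem mem_pow_ord (f : MvPowerSeries (Fin n) K) :
    f ∈ maximalIdeal (MvPowerSeries (Fin n) K) ^ ord f :=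
  mem_maximalIdeal_pow_of_le_order (ENat.coe_toNat_le_self _)

/-- `0 ≠ f ∈ 𝔪ᵈ` has `d ≤ ord f`. [folklore] -/
theorem le_ord_of_mem_pow {f : MvPowerSeries (Fin n) K} (hf : f ≠ 0) {d : ℕ}
    (h : f ∈ maximalIdeal (MvPowerSeries (Fin n) K) ^ d) : d ≤ ord f := by
  have h1 := le_order_of_mem_maximalIdeal_pow h
  have h2 : ((ord f : ℕ) : ℕ∞) = f.order := ne_zero_iff_order_finite.mp hf
  rw [← h2] at h1
  exact_mod_cast h1

/-- A unit of `K⟦x⟧` congruent to `1` modulo `𝔪`. [folklore] -/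
theorem isUnit_of_sub_one_mem {u : MvPowerSeries (Fin n) K}
    (h : u - 1 ∈ maximalIdeal (MvPowerSeries (Fin n) K)) : IsUnit u := by
  rw [mem_maximalIdeal_iff_constantCoeff_eq_zero, map_sub, map_one, sub_eq_zero] at h
  rw [MvPowerSeries.isUnit_iff_constantCoeff, h]
  exact isUnit_one

/-- **`𝔪`-adic completeness of `K⟦x⟧`** (coefficientwise limit): a sequence with
`u_{j+1} - u_j ∈ 𝔪^(j + c)` has a limit `a` with `a - u_j ∈ 𝔪^(j + c)` for all `j`. [folklore] -/
theorem exists_mAdic_limit (u : ℕ → MvPowerSeries (Fin n) K) (c : ℕ)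
    (h : ∀ j, u (j + 1) - u j ∈ maximalIdeal (MvPowerSeries (Fin n) K) ^ (j + c)) :
    ∃ a : MvPowerSeries (Fin n) K, ∀ j, a - u j ∈ maximalIdeal (MvPowerSeries (Fin n) K) ^ (j + c) := by
  -- the coefficients stabilise
  have hstab : ∀ (e : Fin n →₀ ℕ) (j j' : ℕ), j ≤ j' → e.degree < j + c →
      coeff e (u j') = coeff e (u j) := by
    intro e j j' hjj he
    induction j', hjj using Nat.le_induction with
    | base => rfl
    | succ j' hj ih =>
      have h0 := coeff_eq_zero_of_mem_maximalIdeal_pow (h j') (e := e) (by omega)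
      rw [map_sub, sub_eq_zero] at h0
      rw [h0, ih]
  let a : MvPowerSeries (Fin n) K := fun e => coeff e (u (e.degree + 1))
  have ha : ∀ e, coeff e a = coeff e (u (e.degree + 1)) := fun e => rfl
  refine ⟨a, fun j => ?_⟩
  rw [mem_maximalIdeal_pow_iff]
  intro e he
  rw [map_sub, sub_eq_zero, ha]
  rcases le_total j (e.degree + 1) with hj | hj
  · exact hstab e j _ hj he
  · exact (hstab e (e.degree + 1) j hj (by omega)).symm

/-! ### §B. The substitutions `xᵢ ↦ xᵢ + bᵢ` -/

/-- `xᵢ + bᵢ` has no constant term when `bᵢ` has none. [folklore] -/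
theorem constantCoeff_transl {b : Fin n → MvPowerSeries (Fin n) K}
    (hb : ∀ i, constantCoeff (b i) = 0) (i : Fin n) :
    constantCoeff (X i + b i : MvPowerSeries (Fin n) K) = 0 := by
  rw [map_add, constantCoeff_X, hb i, zero_add]

/-- The family `xᵢ + bᵢ` of the printed proof is substitutable (`bᵢ` without constant term).
[cite: BoubakriGreuelMarkwig2010, Lemma 2.2] -/
theorem hasSubst_transl {b : Fin n → MvPowerSeries (Fin n) K}
    (hb : ∀ i, constantCoeff (b i) = 0) :
    HasSubst (fun i => (X i + b i : MvPowerSeries (Fin n) K)) :=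
  hasSubst_of_constantCoeff_zero (constantCoeff_transl hb)

/-- `φ_b (xᵢ) = xᵢ + bᵢ` for the substitution endomorphism `φ_b = substAlgHom (hasSubst_transl _)`.
[folklore] -/
theorem translAlgHom_X {b : Fin n → MvPowerSeries (Fin n) K} (hb : ∀ i, constantCoeff (b i) = 0)
    (i : Fin n) : substAlgHom (R := K) (hasSubst_transl hb) (X i) = X i + b i := by
  rw [substAlgHom_X]

/-- `φ_b` is tangent to the identity when `bᵢ ∈ 𝔪²`. [folklore] -/
theorem tangentId_transl {b : Fin n → MvPowerSeries (Fin n) K}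
    (hb : ∀ i, b i ∈ maximalIdeal (MvPowerSeries (Fin n) K) ^ 2) :
    TangentId (fun i => (X i + b i : MvPowerSeries (Fin n) K)) := by
  classical
  refine ⟨constantCoeff_transl fun i => constantCoeff_eq_zero_of_mem_pow one_le_two (hb i),
    fun i j => ?_⟩
  change coeff (Finsupp.single j 1) (X i + b i) = _
  rw [map_add, coeff_eq_zero_of_mem_maximalIdeal_pow (hb i)
    (by rw [Finsupp.degree_single]; norm_num), add_zero, coeff_X]
  by_cases hij : i = j
  · subst hij
    simp
  · rw [if_neg, if_neg hij]
    exact fun h => hij ((Finsupp.single_left_inj one_ne_zero).mp h).symm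

/-- The compositional inverse family of `xᵢ + bᵢ` (`bᵢ ∈ 𝔪²`) is substitutable. [folklore] -/
theorem hasSubst_invT_transl {b : Fin n → MvPowerSeries (Fin n) K}
    (hb : ∀ i, b i ∈ maximalIdeal (MvPowerSeries (Fin n) K) ^ 2) :
    HasSubst (invT fun i => (X i + b i : MvPowerSeries (Fin n) K)) :=
  hasSubst_of_constantCoeff_zero (constantCoeff_invT (tangentId_transl hb))

/-- `φ_b ∘ φ_b⁻¹ = id` (formal inverse function theorem of the tree). [folklore] -/
theorem transl_comp_invT {b : Fin n → MvPowerSeries (Fin n) K}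
    (hb : ∀ i, b i ∈ maximalIdeal (MvPowerSeries (Fin n) K) ^ 2) :
    (substAlgHom (R := K) (tangentId_transl hb).hasSubst).comp
        (substAlgHom (hasSubst_invT_transl hb)) = AlgHom.id K (MvPowerSeries (Fin n) K) :=
  algHom_ext_X fun s => by
    rw [AlgHom.comp_apply, substAlgHom_apply, substAlgHom_apply, subst_X (hasSubst_invT_transl hb),
      subst_invT_left (tangentId_transl hb)]
    rfl

/-- `φ_b⁻¹ ∘ φ_b = id` (formal inverse function theorem of the tree). [folklore] -/
theorem invT_comp_transl {b : Fin n → MvPowerSeries (Fin n) K}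
    (hb : ∀ i, b i ∈ maximalIdeal (MvPowerSeries (Fin n) K) ^ 2) :
    (substAlgHom (R := K) (hasSubst_invT_transl hb)).comp
        (substAlgHom (tangentId_transl hb).hasSubst) = AlgHom.id K (MvPowerSeries (Fin n) K) :=
  algHom_ext_X fun s => by
    rw [AlgHom.comp_apply, substAlgHom_apply, substAlgHom_apply,
      subst_X (tangentId_transl hb).hasSubst, subst_invT (tangentId_transl hb)]
    rfl

/-- **Two `K`-algebra endomorphisms of `K⟦x⟧` congruent on the variables modulo `𝔪ᴺ` are
congruent modulo `𝔪ᴺ` everywhere** (both are substitutions, and substitution of congruent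
families gives congruent results). [folklore] -/
theorem algHom_sub_mem_pow {φ ψ : MvPowerSeries (Fin n) K →ₐ[K] MvPowerSeries (Fin n) K} {N : ℕ}
    (h : ∀ i, φ (X i) - ψ (X i) ∈ maximalIdeal (MvPowerSeries (Fin n) K) ^ N)
    (a : MvPowerSeries (Fin n) K) : φ a - ψ a ∈ maximalIdeal (MvPowerSeries (Fin n) K) ^ N := by
  cases N with
  | zero => simp
  | succ r =>
    rw [algHom_apply_eq_subst φ a, algHom_apply_eq_subst ψ a, ← le_order_iff_mem_maximalIdeal_pow,
      ← agreeUpTo_iff_order]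
    refine AgreeUpTo.subst_congr (fun i => ?_) (constantCoeff_algHom_X φ)
      (constantCoeff_algHom_X ψ) a
    rw [agreeUpTo_iff_order, le_order_iff_mem_maximalIdeal_pow]
    exact h i

/-- `φ_c (a) ≡ a (mod 𝔪ᴺ)` for every `a` when all `cᵢ ∈ 𝔪ᴺ` (`N ≥ 1`). [folklore] -/
theorem translAlgHom_sub_self_mem_pow {c : Fin n → MvPowerSeries (Fin n) K} {N : ℕ} (hN : 1 ≤ N)
    (hc : ∀ i, c i ∈ maximalIdeal (MvPowerSeries (Fin n) K) ^ N) (a : MvPowerSeries (Fin n) K) :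
    substAlgHom (R := K) (hasSubst_transl fun i => constantCoeff_eq_zero_of_mem_pow hN (hc i)) a
      - a ∈ maximalIdeal (MvPowerSeries (Fin n) K) ^ N := by
  have := algHom_sub_mem_pow
    (φ := substAlgHom (hasSubst_transl fun i => constantCoeff_eq_zero_of_mem_pow hN (hc i)))
    (ψ := AlgHom.id K _) (N := N) (fun i => ?_) a
  · simpa using this
  · rw [translAlgHom_X (fun i => constantCoeff_eq_zero_of_mem_pow hN (hc i)), AlgHom.id_apply,
      add_sub_cancel_left]
    exact hc i

/-! ### §C. The first-order Taylor estimate -/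

/-- The first-order term `δ_b(a) = ∑ᵢ ∂ᵢa · bᵢ` raises the `𝔪`-adic order by `M` when
`bᵢ ∈ 𝔪^(M+1)`. [folklore] -/
theorem sum_pderiv_mul_mem_pow {b : Fin n → MvPowerSeries (Fin n) K} {M : ℕ}
    (hb : ∀ i, b i ∈ maximalIdeal (MvPowerSeries (Fin n) K) ^ (M + 1))
    {a : MvPowerSeries (Fin n) K} {d : ℕ} (ha : a ∈ maximalIdeal (MvPowerSeries (Fin n) K) ^ d) :
    ∑ i, MvPowerSeries.pderiv i a * b i ∈ maximalIdeal (MvPowerSeries (Fin n) K) ^ (d + M) := by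
  refine Ideal.sum_mem _ fun i _ => mem_pow_of_le (d' := d - 1 + (M + 1)) (by omega) ?_
  exact mul_mem_pow_add (pderiv_mem_pow ha i) (hb i)

/-- The Taylor error `E_b(a) = φ_b(a) - a - ∑ᵢ ∂ᵢa · bᵢ` (the `h` of the printed proof) vanishes
at `a = 1`. [folklore] -/
theorem taylorErr_one {b : Fin n → MvPowerSeries (Fin n) K} (hb0 : ∀ i, constantCoeff (b i) = 0) :
    substAlgHom (R := K) (hasSubst_transl hb0) 1 - 1
      - ∑ i, MvPowerSeries.pderiv i (1 : MvPowerSeries (Fin n) K) * b i = 0 := by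
  rw [map_one, sub_self, zero_sub, neg_eq_zero]
  exact Finset.sum_eq_zero fun i _ => by rw [Derivation.map_one_eq_zero, zero_mul]

/-- **The recursion `E(xᵢ·c) = bᵢ·δ(c) + (xᵢ + bᵢ)·E(c)`** for the Taylor error (Leibniz).
[folklore] -/
theorem taylorErr_X_mul {b : Fin n → MvPowerSeries (Fin n) K} (hb0 : ∀ i, constantCoeff (b i) = 0)
    (i : Fin n) (c : MvPowerSeries (Fin n) K) :
    substAlgHom (R := K) (hasSubst_transl hb0) (X i * c) - X i * c
        - ∑ j, MvPowerSeries.pderiv j (X i * c) * b j =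
      b i * ∑ j, MvPowerSeries.pderiv j c * b j +
        (X i + b i) * (substAlgHom (R := K) (hasSubst_transl hb0) c - c
          - ∑ j, MvPowerSeries.pderiv j c * b j) := by
  classical
  have hsum : ∑ j, MvPowerSeries.pderiv j (X i * c) * b j =
      X i * ∑ j, MvPowerSeries.pderiv j c * b j + c * b i := by
    simp only [Derivation.leibniz, smul_eq_mul, MvPowerSeries.pderiv_X, add_mul,
      Finset.sum_add_distrib, Finset.mul_sum]
    congr 1
    · exact Finset.sum_congr rfl fun j _ => by ring
    · rw [Finset.sum_eq_single i]
      · simp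
      · intro j _ hji
        rw [if_neg (Ne.symm hji), mul_zero, zero_mul]
      · intro h
        exact (h (Finset.mem_univ i)).elim
  rw [hsum, map_mul, translAlgHom_X hb0]
  ring

/-- The Taylor estimate on monomials: `E_b(xᵉ) ∈ 𝔪^(|e| + 2M)` for `bᵢ ∈ 𝔪^(M+1)`.
[cite: BoubakriGreuelMarkwig2010, proof of Thm. 2.1] -/
theorem taylorErr_monomial_mem_pow {b : Fin n → MvPowerSeries (Fin n) K} {M : ℕ}
    (hb : ∀ i, b i ∈ maximalIdeal (MvPowerSeries (Fin n) K) ^ (M + 1))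
    (hb0 : ∀ i, constantCoeff (b i) = 0) :
    ∀ (D : ℕ) (e : Fin n →₀ ℕ), e.degree = D →
      substAlgHom (R := K) (hasSubst_transl hb0) (monomial e (1 : K)) - monomial e (1 : K)
          - ∑ i, MvPowerSeries.pderiv i (monomial e (1 : K)) * b i ∈
        maximalIdeal (MvPowerSeries (Fin n) K) ^ (D + 2 * M) := by
  classical
  intro D
  induction D with
  | zero =>
    intro e he
    rw [(Finsupp.degree_eq_zero_iff e).mp he, monomial_zero_one, taylorErr_one hb0]
    exact Ideal.zero_mem _
  | succ D ih =>
    intro e he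
    have he0 : e ≠ 0 := by
      intro h0
      rw [h0, map_zero] at he
      exact Nat.succ_ne_zero D he.symm
    obtain ⟨i, hi⟩ : ∃ i, e i ≠ 0 := by
      by_contra hne
      push Not at hne
      exact he0 (Finsupp.ext hne)
    set e' : Fin n →₀ ℕ := e - Finsupp.single i 1 with he'
    have hee : e = Finsupp.single i 1 + e' := by
      ext j
      simp only [he', Finsupp.coe_add, Finsupp.coe_tsub, Pi.add_apply, Pi.sub_apply,
        Finsupp.single_apply]
      split_ifs with hij
      · subst hij; omega
      · omega
    have hdeg : e'.degree = D := by
      have := congrArg Finsupp.degree hee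
      rw [map_add, Finsupp.degree_single, he] at this
      omega
    have hmon : monomial e (1 : K) = X i * monomial e' (1 : K) := by
      rw [hee, X_def, monomial_mul_monomial, one_mul]
    rw [hmon, taylorErr_X_mul hb0]
    have hc : (monomial e' (1 : K) : MvPowerSeries (Fin n) K) ∈
        maximalIdeal (MvPowerSeries (Fin n) K) ^ D :=
      monomial_mem_maximalIdeal_pow hdeg.ge 1
    refine Ideal.add_mem _ ?_ ?_
    · exact mem_pow_of_le (d' := M + 1 + (D + M)) (by omega)
        (mul_mem_pow_add (hb i) (sum_pderiv_mul_mem_pow hb hc))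
    · have hX : X i + b i ∈ maximalIdeal (MvPowerSeries (Fin n) K) ^ 1 := by
        rw [pow_one]
        exact Ideal.add_mem _ (mem_maximalIdeal_iff_constantCoeff_eq_zero.2 (constantCoeff_X i))
          (Ideal.pow_le_self (Nat.succ_ne_zero M) (hb i))
      exact mem_pow_of_le (d' := 1 + (D + 2 * M)) (by omega) (mul_mem_pow_add hX (ih e' hdeg))

/-- **First-order Taylor estimate** (the bound `h ∈ 𝔪^(N+2)` of the printed proof): for
`a ∈ 𝔪ᵈ` and `bᵢ ∈ 𝔪^(M+1)`, `φ_b(a) - a - ∑ᵢ ∂ᵢa · bᵢ ∈ 𝔪^(d + 2M)`.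
[cite: BoubakriGreuelMarkwig2010, proof of Thm. 2.1] -/
theorem taylorErr_mem_pow {b : Fin n → MvPowerSeries (Fin n) K} {M : ℕ}
    (hb : ∀ i, b i ∈ maximalIdeal (MvPowerSeries (Fin n) K) ^ (M + 1))
    (hb0 : ∀ i, constantCoeff (b i) = 0) {a : MvPowerSeries (Fin n) K} {d : ℕ}
    (ha : a ∈ maximalIdeal (MvPowerSeries (Fin n) K) ^ d) :
    substAlgHom (R := K) (hasSubst_transl hb0) a - a - ∑ i, MvPowerSeries.pderiv i a * b i ∈
      maximalIdeal (MvPowerSeries (Fin n) K) ^ (d + 2 * M) := by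
  classical
  -- the Taylor error as a `K`-linear map
  let E : MvPowerSeries (Fin n) K →ₗ[K] MvPowerSeries (Fin n) K :=
    (substAlgHom (R := K) (hasSubst_transl hb0)).toLinearMap - LinearMap.id -
      ∑ i, (LinearMap.mulRight K (b i)).comp (MvPowerSeries.pderiv i).toLinearMap
  have hE : ∀ x, E x = substAlgHom (R := K) (hasSubst_transl hb0) x - x -
      ∑ i, MvPowerSeries.pderiv i x * b i := fun x => by
    simp [E, LinearMap.sum_apply]
  rw [← hE]
  set T := d + 2 * M with hT
  have hsplit : a = ((truncTotal T a : MvPolynomial (Fin n) K) : MvPowerSeries (Fin n) K) +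
      (a - ↑(truncTotal T a)) := by
    ring
  have hr : a - ↑(truncTotal T a) ∈ maximalIdeal (MvPowerSeries (Fin n) K) ^ T :=
    sub_coe_truncTotal_mem_maximalIdeal_pow T a
  rw [hsplit, map_add]
  refine Ideal.add_mem _ ?_ ?_
  · -- the polynomial part: a `K`-combination of monomials of degree in `[d, T)`
    rw [(truncTotal T a).as_sum, ← MvPolynomial.coeToMvPowerSeries.ringHom_apply, map_sum, map_sum]
    refine Ideal.sum_mem _ fun v hv => ?_
    have hvd : d ≤ v.degree := by
      by_contra hlt
      push Not at hlt
      refine (MvPolynomial.mem_support_iff.1 hv) ?_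
      rw [coeff_truncTotal _ (lt_of_lt_of_le hlt (by omega))]
      exact coeff_eq_zero_of_mem_maximalIdeal_pow ha hlt
    rw [MvPolynomial.coeToMvPowerSeries.ringHom_apply, MvPolynomial.coe_monomial,
      ← mul_one (MvPolynomial.coeff v (truncTotal T a)), ← smul_eq_mul, map_smul, map_smul]
    refine Submodule.smul_of_tower_mem _ _ (mem_pow_of_le (d' := v.degree + 2 * M) (by omega) ?_)
    rw [hE]
    exact taylorErr_monomial_mem_pow hb hb0 _ v rfl
  · -- the remainder
    rw [hE]
    refine Ideal.sub_mem _ (Ideal.sub_mem _ (algHom_apply_mem_maximalIdeal_pow _ hr) hr) ?_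
    exact mem_pow_of_le (d' := T + M) (by omega) (sum_pderiv_mul_mem_pow hb hr)

/-! ### §D. The iteration of the printed proof (Lemma 2.2) and its limit -/

/-- **One step of the iteration** (proof of Thm. 2.1 with the recursion of Lemma 2.2): from
`g - u·Φ(f) ∈ 𝔪^(N+1+p)` to `g - u'·Φ'(f) ∈ 𝔪^(N+2+p)` with `Φ' = φ_c ∘ Φ`,
`u' = (1 + c₀)·φ_c(u)`, `Φ' ≡ Φ (mod 𝔪^(M+1+p))` on the variables and `u' ≡ u (mod 𝔪^(M+p))`.
The residual is decomposed by `hdec` (the hypothesis of Thm. 2.1 multiplied by `𝔪^(M-1+p)`) and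
the error is controlled by the Taylor estimate `taylorErr_mem_pow`.
[cite: BoubakriGreuelMarkwig2010, proof of Thm. 2.1 and Lemma 2.2] -/
theorem step {f g : MvPowerSeries (Fin n) K} {o M N : ℕ} {useUnit : Prop} (hM : 1 ≤ M)
    (hoN : o ≤ N + 1) (hNM : N + 2 ≤ o + 2 * M)
    (hfo : f ∈ maximalIdeal (MvPowerSeries (Fin n) K) ^ o)
    (hfg : f - g ∈ maximalIdeal (MvPowerSeries (Fin n) K) ^ (N + 1))
    (hdec : ∀ (p : ℕ) (r : MvPowerSeries (Fin n) K),
      r ∈ maximalIdeal (MvPowerSeries (Fin n) K) ^ (N + 1 + p) →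
      ∃ (c₀ : MvPowerSeries (Fin n) K) (c : Fin n → MvPowerSeries (Fin n) K), (useUnit ∨ c₀ = 0) ∧
        c₀ ∈ maximalIdeal (MvPowerSeries (Fin n) K) ^ (M + p) ∧
        (∀ i, c i ∈ maximalIdeal (MvPowerSeries (Fin n) K) ^ (M + 1 + p)) ∧
        r = c₀ * f + ∑ i, MvPowerSeries.pderiv i f * c i)
    (p : ℕ) (Φ : MvPowerSeries (Fin n) K →ₐ[K] MvPowerSeries (Fin n) K) (u : MvPowerSeries (Fin n) K)
    (hu : useUnit ∨ u = 1)
    (hr : g - u * Φ f ∈ maximalIdeal (MvPowerSeries (Fin n) K) ^ (N + 1 + p)) :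
    ∃ (Φ' : MvPowerSeries (Fin n) K →ₐ[K] MvPowerSeries (Fin n) K) (u' : MvPowerSeries (Fin n) K),
      (∀ i, Φ' (X i) - Φ (X i) ∈ maximalIdeal (MvPowerSeries (Fin n) K) ^ (M + 1 + p)) ∧
      u' - u ∈ maximalIdeal (MvPowerSeries (Fin n) K) ^ (M + p) ∧ (useUnit ∨ u' = 1) ∧
      g - u' * Φ' f ∈ maximalIdeal (MvPowerSeries (Fin n) K) ^ (N + 1 + (p + 1)) := by
  obtain ⟨c₀, c, hc₀0, hc₀, hc, hrdec⟩ := hdec p _ hr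
  have hc0 : ∀ i, constantCoeff (c i) = 0 := fun i =>
    constantCoeff_eq_zero_of_mem_pow (by omega) (hc i)
  have hc' : ∀ i, c i ∈ maximalIdeal (MvPowerSeries (Fin n) K) ^ (M + p + 1) := fun i => by
    rw [show M + p + 1 = M + 1 + p by omega]
    exact hc i
  set φ : MvPowerSeries (Fin n) K →ₐ[K] MvPowerSeries (Fin n) K :=
    substAlgHom (hasSubst_transl hc0) with hφ
  set F := u * Φ f with hF
  have hfF : f - F ∈ maximalIdeal (MvPowerSeries (Fin n) K) ^ (N + 1) := by
    have : f - F = (f - g) + (g - F) := by ring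
    rw [this]
    exact Ideal.add_mem _ hfg (mem_pow_of_le (by omega) hr)
  have hFo : F ∈ maximalIdeal (MvPowerSeries (Fin n) K) ^ o := by
    have : F = f - (f - F) := by ring
    rw [this]
    exact Ideal.sub_mem _ hfo (mem_pow_of_le hoN hfF)
  refine ⟨φ.comp Φ, (1 + c₀) * φ u, fun i => ?_, ?_, ?_, ?_⟩
  · rw [AlgHom.comp_apply]
    exact translAlgHom_sub_self_mem_pow (by omega) hc _
  · have : (1 + c₀) * φ u - u = (φ u - u) + c₀ * φ u := by ring
    rw [this]
    exact Ideal.add_mem _ (mem_pow_of_le (by omega) (translAlgHom_sub_self_mem_pow (by omega) hc _))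
      (Ideal.mul_mem_right _ _ hc₀)
  · rcases hu with h | h
    · exact Or.inl h
    · rcases hc₀0 with h' | h'
      · exact Or.inl h'
      · right
        rw [h, h', map_one]
        ring
  · -- the residual at the next stage
    have hφF : φ u * φ (Φ f) = (φ F - F - ∑ i, MvPowerSeries.pderiv i F * c i) + F +
        ∑ i, MvPowerSeries.pderiv i F * c i := by
      rw [← map_mul]
      ring
    have hgF : g - F = c₀ * f + ∑ i, MvPowerSeries.pderiv i f * c i := by rw [hF, hrdec]
    have hδ : ∑ i, MvPowerSeries.pderiv i (f - F) * c i =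
        ∑ i, MvPowerSeries.pderiv i f * c i - ∑ i, MvPowerSeries.pderiv i F * c i := by
      simp only [map_sub, sub_mul, Finset.sum_sub_distrib]
    have key : g - (1 + c₀) * φ u * (φ.comp Φ) f =
        c₀ * (f - F) + ∑ i, MvPowerSeries.pderiv i (f - F) * c i
          - c₀ * ∑ i, MvPowerSeries.pderiv i F * c i
          - (1 + c₀) * (φ F - F - ∑ i, MvPowerSeries.pderiv i F * c i) := by
      rw [AlgHom.comp_apply]
      linear_combination hgF - (1 + c₀) * hφF - hδ
    rw [key]
    refine Ideal.sub_mem _ (Ideal.sub_mem _ (Ideal.add_mem _ ?_ ?_) ?_) ?_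
    · exact mem_pow_of_le (by omega) (mul_mem_pow_add hc₀ hfF)
    · exact mem_pow_of_le (by omega) (sum_pderiv_mul_mem_pow hc' hfF)
    · exact mem_pow_of_le (by omega) (mul_mem_pow_add hc₀ (sum_pderiv_mul_mem_pow hc' hFo))
    · exact Ideal.mul_mem_left _ _ (mem_pow_of_le (by omega) (taylorErr_mem_pow hc' hc0 hFo))

/-- **The limit argument** (Lemma 2.2 and the end of the proof of Thm. 2.1): under the
decomposition hypothesis `hdec`, every `g` with `f - g ∈ 𝔪^(N+1)` is `g = u · Ψ(f)` for an
automorphism `Ψ` (`Ψ(xᵢ) = xᵢ + bᵢ`, `bᵢ ∈ 𝔪^(M+1)`, inverted by the formal inverse function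
theorem) and a unit `u ≡ 1 (mod 𝔪ᴹ)`, with `u = 1` in the right-equivalence case
(`useUnit = False`). [cite: BoubakriGreuelMarkwig2010, Lemma 2.2 and proof of Thm. 2.1] -/
theorem engine {f g : MvPowerSeries (Fin n) K} {o M N : ℕ} {useUnit : Prop} (hM : 1 ≤ M)
    (hoN : o ≤ N + 1) (hNM : N + 2 ≤ o + 2 * M) (hMN : M ≤ N + 1)
    (hfo : f ∈ maximalIdeal (MvPowerSeries (Fin n) K) ^ o)
    (hfg : f - g ∈ maximalIdeal (MvPowerSeries (Fin n) K) ^ (N + 1))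
    (hdec : ∀ (p : ℕ) (r : MvPowerSeries (Fin n) K),
      r ∈ maximalIdeal (MvPowerSeries (Fin n) K) ^ (N + 1 + p) →
      ∃ (c₀ : MvPowerSeries (Fin n) K) (c : Fin n → MvPowerSeries (Fin n) K), (useUnit ∨ c₀ = 0) ∧
        c₀ ∈ maximalIdeal (MvPowerSeries (Fin n) K) ^ (M + p) ∧
        (∀ i, c i ∈ maximalIdeal (MvPowerSeries (Fin n) K) ^ (M + 1 + p)) ∧
        r = c₀ * f + ∑ i, MvPowerSeries.pderiv i f * c i) :
    ∃ (Ψ : MvPowerSeries (Fin n) K ≃ₐ[K] MvPowerSeries (Fin n) K) (u : MvPowerSeries (Fin n) K),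
      IsUnit u ∧ (useUnit ∨ u = 1) ∧ g = u * Ψ f := by
  -- the states of the iteration: `(Φ_p, u_p)` with the invariant `g - u_p Φ_p(f) ∈ 𝔪^(N+1+p)`
  let St : ℕ → Type _ := fun p =>
    {s : (MvPowerSeries (Fin n) K →ₐ[K] MvPowerSeries (Fin n) K) × MvPowerSeries (Fin n) K //
      (useUnit ∨ s.2 = 1) ∧ g - s.2 * s.1 f ∈ maximalIdeal (MvPowerSeries (Fin n) K) ^ (N + 1 + p)}
  have hstep : ∀ (p : ℕ) (s : St p), ∃ s' : St (p + 1),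
      (∀ i, s'.1.1 (X i) - s.1.1 (X i) ∈ maximalIdeal (MvPowerSeries (Fin n) K) ^ (M + 1 + p)) ∧
        s'.1.2 - s.1.2 ∈ maximalIdeal (MvPowerSeries (Fin n) K) ^ (M + p) := by
    intro p s
    obtain ⟨Φ', u', h1, h2, h3, h4⟩ := step hM hoN hNM hfo hfg hdec p s.1.1 s.1.2 s.2.1 s.2.2
    exact ⟨⟨(Φ', u'), h3, h4⟩, h1, h2⟩
  choose next hnextΦ hnextu using hstep
  have h0 : g - 1 * (AlgHom.id K (MvPowerSeries (Fin n) K)) f ∈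
      maximalIdeal (MvPowerSeries (Fin n) K) ^ (N + 1 + 0) := by
    rw [one_mul, AlgHom.id_apply, add_zero, ← neg_sub]
    exact Submodule.neg_mem _ hfg
  let s0 : St 0 := ⟨(AlgHom.id K _, 1), Or.inr rfl, h0⟩
  let seq : ∀ p, St p := fun p => Nat.rec (motive := fun p => St p) s0 (fun p s => next p s) p
  have seq_zero : seq 0 = s0 := rfl
  have seq_succ : ∀ p, seq (p + 1) = next p (seq p) := fun p => rfl
  -- the Cauchy estimates of Lemma 2.2
  have hΦc : ∀ i p, (seq (p + 1)).1.1 (X i) - (seq p).1.1 (X i) ∈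
      maximalIdeal (MvPowerSeries (Fin n) K) ^ (p + (M + 1)) := by
    intro i p
    rw [seq_succ, show p + (M + 1) = M + 1 + p by omega]
    exact hnextΦ p (seq p) i
  have huc : ∀ p, (seq (p + 1)).1.2 - (seq p).1.2 ∈
      maximalIdeal (MvPowerSeries (Fin n) K) ^ (p + M) := by
    intro p
    rw [seq_succ, show p + M = M + p by omega]
    exact hnextu p (seq p)
  -- the limits `Ψ(xᵢ) = lim Φ_p(xᵢ)` and `u = lim u_p`
  choose L hL using fun i => exists_mAdic_limit (fun p => (seq p).1.1 (X i)) (M + 1) (hΦc i)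
  obtain ⟨u, hu⟩ := exists_mAdic_limit (fun p => (seq p).1.2) M huc
  have hB : ∀ i, L i - X i ∈ maximalIdeal (MvPowerSeries (Fin n) K) ^ (M + 1) := by
    intro i
    have := hL i 0
    rwa [seq_zero, zero_add] at this
  have hB2 : ∀ i, L i - X i ∈ maximalIdeal (MvPowerSeries (Fin n) K) ^ 2 := fun i =>
    mem_pow_of_le (by omega) (hB i)
  -- `Ψ : xᵢ ↦ L i = xᵢ + (L i - xᵢ)`, an automorphism by the formal inverse function theorem
  let Ψ : MvPowerSeries (Fin n) K ≃ₐ[K] MvPowerSeries (Fin n) K :=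
    AlgEquiv.ofAlgHom (substAlgHom (tangentId_transl hB2).hasSubst)
      (substAlgHom (hasSubst_invT_transl hB2)) (transl_comp_invT hB2) (invT_comp_transl hB2)
  have hΨX : ∀ i, Ψ (X i) = L i := by
    intro i
    change AlgEquiv.ofAlgHom _ _ _ _ (X i) = L i
    rw [AlgEquiv.ofAlgHom_apply, substAlgHom_apply, subst_X (tangentId_transl hB2).hasSubst]
    ring
  have hΦΨ : ∀ (p : ℕ) (a : MvPowerSeries (Fin n) K), (seq p).1.1 a - Ψ a ∈
      maximalIdeal (MvPowerSeries (Fin n) K) ^ (p + (M + 1)) := by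
    intro p a
    have := algHom_sub_mem_pow (φ := (seq p).1.1)
      (ψ := (Ψ : MvPowerSeries (Fin n) K →ₐ[K] MvPowerSeries (Fin n) K)) (N := p + (M + 1))
      (fun i => ?_) a
    · simpa using this
    · rw [AlgEquiv.coe_toAlgHom, hΨX, ← neg_sub]
      exact Submodule.neg_mem _ (hL i p)
  -- `g = u · Ψ(f)`
  have hfinal : ∀ p, g - u * Ψ f ∈ maximalIdeal (MvPowerSeries (Fin n) K) ^ (p + M) := by
    intro p
    have hres := (seq p).2.2
    have hid : g - u * Ψ f = (g - (seq p).1.2 * (seq p).1.1 f) +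
        ((seq p).1.2 - u) * (seq p).1.1 f + u * ((seq p).1.1 f - Ψ f) := by ring
    rw [hid]
    refine Ideal.add_mem _ (Ideal.add_mem _ (mem_pow_of_le (by omega) hres)
      (Ideal.mul_mem_right _ _ ?_)) (Ideal.mul_mem_left _ _ (mem_pow_of_le (by omega) (hΦΨ p f)))
    rw [← neg_sub]
    exact Submodule.neg_mem _ (hu p)
  have hg : g = u * Ψ f := by
    rw [← sub_eq_zero]
    exact eq_zero_of_forall_mem_pow fun d => mem_pow_of_le (by omega) (hfinal d)
  have hunit : IsUnit u := by
    refine isUnit_of_sub_one_mem ?_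
    have := hu 0
    rw [seq_zero, zero_add] at this
    simpa using mem_pow_of_le (d := 1) hM this
  have hu1 : useUnit ∨ u = 1 := by
    by_cases hU : useUnit
    · exact Or.inl hU
    · right
      rw [← sub_eq_zero]
      refine eq_zero_of_forall_mem_pow fun d => ?_
      have h1 : (seq d).1.2 = 1 := (seq d).2.1.resolve_left hU
      have := hu d
      rw [h1] at this
      exact mem_pow_of_le (by omega) this
  exact ⟨Ψ, u, hunit, hu1, hg⟩

/-! ### §E. Theorem 2.1 -/

/-- First line of the printed proof: `𝔪^(k+2) ⊆ 𝔪^(ord f + 1)` forces `k ≥ ord f - 1`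
(look at `x₁^(k+2)`). [cite: BoubakriGreuelMarkwig2010, proof of Thm. 2.1] -/
theorem ord_le_of_pow_le {f : MvPowerSeries (Fin n) K} {k : ℕ} (hn : 0 < n)
    (h : maximalIdeal (MvPowerSeries (Fin n) K) ^ (k + 2) ≤
      maximalIdeal (MvPowerSeries (Fin n) K) ^ (ord f + 1)) :
    ord f ≤ k + 1 := by
  by_contra hlt
  push Not at hlt
  have hX : (X ⟨0, hn⟩ : MvPowerSeries (Fin n) K) ^ (k + 2) ∈
      maximalIdeal (MvPowerSeries (Fin n) K) ^ (ord f + 1) :=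
    h (Ideal.pow_mem_pow (mem_maximalIdeal_iff_constantCoeff_eq_zero.2 (constantCoeff_X _)) _)
  have h0 := coeff_eq_zero_of_mem_maximalIdeal_pow hX (e := Finsupp.single ⟨0, hn⟩ (k + 2))
    (by rw [Finsupp.degree_single]; omega)
  rw [X_pow_eq, coeff_monomial_same] at h0
  exact one_ne_zero h0

/-- The Jacobian ideal of `f` lies in `𝔪^(ord f - 1)`. [folklore] -/
theorem jacobianIdeal_le_pow (f : MvPowerSeries (Fin n) K) :
    jacobianIdeal f ≤ maximalIdeal (MvPowerSeries (Fin n) K) ^ (ord f - 1) :=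
  Ideal.span_le.mpr (by
    rintro _ ⟨i, rfl⟩
    exact pderiv_mem_pow (mem_pow_ord f) i)

/-- **Theorem 2.1 (2), contact determinacy**, for any field `K` and any `n ≥ 1`: if
`0 ≠ f ∈ 𝔪²` and `𝔪^(k+2) ⊆ 𝔪·⟨f⟩ + 𝔪²·j(f)` then `f` is contact `(2k - ord f + 2)`-determined.
[cite: BoubakriGreuelMarkwig2010, Thm. 2.1(2)] -/
theorem isContactDetermined_of_pow_le {f : MvPowerSeries (Fin n) K} {k : ℕ} (hn : 0 < n)
    (hf : f ≠ 0) (hf2 : f ∈ maximalIdeal (MvPowerSeries (Fin n) K) ^ 2)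
    (hyp : maximalIdeal (MvPowerSeries (Fin n) K) ^ (k + 2) ≤
      maximalIdeal (MvPowerSeries (Fin n) K) * Ideal.span {f} +
        maximalIdeal (MvPowerSeries (Fin n) K) ^ 2 * jacobianIdeal f) :
    IsContactDetermined (2 * k + 2 - ord f) f := by
  have ho2 : 2 ≤ ord f := le_ord_of_mem_pow hf hf2
  have hfo := mem_pow_ord f
  have hI : maximalIdeal (MvPowerSeries (Fin n) K) * Ideal.span {f} +
      maximalIdeal (MvPowerSeries (Fin n) K) ^ 2 * jacobianIdeal f ≤
      maximalIdeal (MvPowerSeries (Fin n) K) ^ (ord f + 1) := by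
    refine sup_le ?_ ?_
    · rw [pow_succ']
      exact Ideal.mul_mono_right ((Ideal.span_singleton_le_iff_mem _).mpr hfo)
    · rw [show ord f + 1 = 2 + (ord f - 1) by omega, pow_add]
      exact Ideal.mul_mono_right (jacobianIdeal_le_pow f)
  have hok : ord f ≤ k + 1 := ord_le_of_pow_le hn (hyp.trans hI)
  intro g hfg
  obtain ⟨Ψ, u, hunit, -, hg⟩ := engine (K := K) (o := ord f) (M := k + 2 - ord f)
    (N := 2 * k + 2 - ord f) (useUnit := True) (f := f) (g := g) (by omega) (by omega) (by omega)
    (by omega) hfo hfg (by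
      intro p r hr
      have hr' : r ∈ maximalIdeal (MvPowerSeries (Fin n) K) ^ (k + 2 - ord f - 1 + p) *
          (maximalIdeal (MvPowerSeries (Fin n) K) * Ideal.span {f} +
            maximalIdeal (MvPowerSeries (Fin n) K) ^ 2 * jacobianIdeal f) := by
        have : maximalIdeal (MvPowerSeries (Fin n) K) ^ (2 * k + 2 - ord f + 1 + p) =
            maximalIdeal (MvPowerSeries (Fin n) K) ^ (k + 2 - ord f - 1 + p) *
              maximalIdeal (MvPowerSeries (Fin n) K) ^ (k + 2) := by
          rw [← pow_add]
          congr 1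
          omega
        rw [this] at hr
        exact Ideal.mul_mono_right hyp hr
      rw [mul_add, ← mul_assoc, ← mul_assoc, ← pow_succ, ← pow_add] at hr'
      obtain ⟨r₁, hr₁, r₂, hr₂, rfl⟩ := Submodule.mem_sup.mp hr'
      obtain ⟨c₀, hc₀, rfl⟩ := Ideal.mem_mul_span_singleton.mp hr₁
      obtain ⟨a, ha, rfl⟩ := (Submodule.mem_ideal_smul_span_iff_exists_sum _ _ _).mp hr₂
      refine ⟨c₀, fun i => a i, Or.inl trivial, ?_, fun i => ?_, ?_⟩
      · rw [show k + 2 - ord f + p = k + 2 - ord f - 1 + p + 1 by omega]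
        exact hc₀
      · rw [show k + 2 - ord f + 1 + p = k + 2 - ord f - 1 + p + 2 by omega]
        exact ha i
      · rw [Finsupp.sum_fintype _ _ (fun i => by simp)]
        congr 1
        exact Finset.sum_congr rfl fun i _ => by rw [smul_eq_mul, mul_comm])
  have h1 : Ψ.symm g = Ψ.symm u * f := by
    rw [hg, map_mul, AlgEquiv.symm_apply_apply]
  refine ⟨Ψ.symm, (hunit.map Ψ.symm).unit⁻¹, ?_⟩
  rw [h1, ← mul_assoc, IsUnit.val_inv_mul, one_mul]

/-- **Theorem 2.1 (1), right determinacy**, for any field `K` and any `n ≥ 1`: if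
`0 ≠ f ∈ 𝔪²` and `𝔪^(k+2) ⊆ 𝔪²·j(f)` then `f` is right `(2k - ord f + 2)`-determined.
[cite: BoubakriGreuelMarkwig2010, Thm. 2.1(1)] -/
theorem isRightDetermined_of_pow_le {f : MvPowerSeries (Fin n) K} {k : ℕ} (hn : 0 < n)
    (hf : f ≠ 0) (hf2 : f ∈ maximalIdeal (MvPowerSeries (Fin n) K) ^ 2)
    (hyp : maximalIdeal (MvPowerSeries (Fin n) K) ^ (k + 2) ≤
      maximalIdeal (MvPowerSeries (Fin n) K) ^ 2 * jacobianIdeal f) :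
    IsRightDetermined (2 * k + 2 - ord f) f := by
  have ho2 : 2 ≤ ord f := le_ord_of_mem_pow hf hf2
  have hfo := mem_pow_ord f
  have hI : maximalIdeal (MvPowerSeries (Fin n) K) ^ 2 * jacobianIdeal f ≤
      maximalIdeal (MvPowerSeries (Fin n) K) ^ (ord f + 1) := by
    rw [show ord f + 1 = 2 + (ord f - 1) by omega, pow_add]
    exact Ideal.mul_mono_right (jacobianIdeal_le_pow f)
  have hok : ord f ≤ k + 1 := ord_le_of_pow_le hn (hyp.trans hI)
  intro g hfg
  obtain ⟨Ψ, u, -, hu1, hg⟩ := engine (K := K) (o := ord f) (M := k + 2 - ord f)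
    (N := 2 * k + 2 - ord f) (useUnit := False) (f := f) (g := g) (by omega) (by omega) (by omega)
    (by omega) hfo hfg (by
      intro p r hr
      have hr' : r ∈ maximalIdeal (MvPowerSeries (Fin n) K) ^ (k + 2 - ord f - 1 + p) *
          (maximalIdeal (MvPowerSeries (Fin n) K) ^ 2 * jacobianIdeal f) := by
        have : maximalIdeal (MvPowerSeries (Fin n) K) ^ (2 * k + 2 - ord f + 1 + p) =
            maximalIdeal (MvPowerSeries (Fin n) K) ^ (k + 2 - ord f - 1 + p) *
              maximalIdeal (MvPowerSeries (Fin n) K) ^ (k + 2) := by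
          rw [← pow_add]
          congr 1
          omega
        rw [this] at hr
        exact Ideal.mul_mono_right hyp hr
      rw [← mul_assoc, ← pow_add] at hr'
      obtain ⟨a, ha, rfl⟩ := (Submodule.mem_ideal_smul_span_iff_exists_sum _ _ _).mp hr'
      refine ⟨0, fun i => a i, Or.inr rfl, Ideal.zero_mem _, fun i => ?_, ?_⟩
      · rw [show k + 2 - ord f + 1 + p = k + 2 - ord f - 1 + p + 2 by omega]
        exact ha i
      · rw [Finsupp.sum_fintype _ _ (fun i => by simp), zero_mul, zero_add]
        exact Finset.sum_congr rfl fun i _ => by rw [smul_eq_mul, mul_comm])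
  have hu : u = 1 := hu1.resolve_left id
  refine ⟨Ψ.symm, ?_⟩
  rw [hg, hu, one_mul, AlgEquiv.symm_apply_apply]

/-- **Boubakri–Greuel–Markwig, Theorem 2.1** (discharge of the named fact `Thm21`): for `K`
algebraically closed of any characteristic, `n ≥ 2`, `0 ≠ f ∈ 𝔪² ⊆ K⟦x₁,…,xₙ⟧` and `k ∈ ℕ`,
(1) `𝔪^(k+2) ⊆ 𝔪²·j(f)` ⇒ `f` is right `(2k - ord f + 2)`-determined;
(2) `𝔪^(k+2) ⊆ 𝔪·⟨f⟩ + 𝔪²·j(f)` ⇒ `f` is contact `(2k - ord f + 2)`-determined.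
(Proved above for every field and every `n ≥ 1`: `isRightDetermined_of_pow_le`,
`isContactDetermined_of_pow_le`.) [cite: BoubakriGreuelMarkwig2010, Thm. 2.1] -/
theorem Thm21_holds : Thm21 := by
  intro K _ _ n hn f k hf hf2
  exact ⟨fun h => isRightDetermined_of_pow_le (by omega) hf hf2 h,
    fun h => isContactDetermined_of_pow_le (by omega) hf hf2 h⟩

end BoubakriGreuelMarkwig

end Literature.AlgebraicGeometry.Resolution

end
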